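import Summits.PneNP.PneNP.Theorems.CliqueExtLowerBound.Negative.AnchoredThetaCounting
import Summits.PneNP.PneNP.Theorems.CliqueExtLowerBound.Negative.AnchoredThetaChildren
import Summits.PneNP.PneNP.Theorems.CliqueExtLowerBound.Negative.AnchoredThetaHelpers

/-!
# Exit (i) of Jukna's criterion is absurd on the anchored negatives (anchored-theta refutation, part E2)

Part of the refutation of `stub_convReplaceable` (line `width-threshold-certificate-sparsity` of
crux stmt-PneNP-10682, `ConvexRankGates.CliqueExtLowerBound`) by the ANCHORED THETA GATE; the final
theorem is `stub_convReplaceable_false` in `ConvReplaceableFalse.lean`, whose module docstring has the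
overview. Witness: at `c = 3`, for every `a`, localities `r = 3, s = 4`, at every large `m = n + 2`, the
theta programme on the `n+1` non-anchor vertices with clique parameter `k-1` (`k = ⌈m^{1/4}⌉₊`), fed
with children `d_j = {{e₀, p_j}}`, `c_j = {{e₀, f(α,γ), f(β,γ)} : γ < h}`, is not replaceable by any
monotone circuit of size `m^a`: Jukna's criterion on the derived coordinates kills both exits.
-/

set_option linter.dupNamespace false

namespace Summit.PneNP.PneNP.Theorems.CliqueExtLowerBound.Negative

open Literature.Computability.Complexity Literature.Combinatorics.SimpleGraph Matrix Finset Filter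

noncomputable section

section FiniteNeg

open Classical in
/-- **Exit (i) is absurd** (negatives): if `C ≤ Ψ` for an exact `s'`-CNF `C` of `≤ Z (r'-1)^{s'}`
clauses, then `Ψ` accepts all but few of the fully classified anchored negatives, which the gate
rejects, against (V2). -/
theorem caseNeg_absurd (n k t h Cmax s' v e Dm : ℕ) (ε : ℝ) (hε : 0 ≤ ε)
    (hh1 : 1 ≤ h) (hh2 : 2 * h ≤ n) (hhk : h < k - 1)
    (hD1 : 1 ≤ Dm) (hhD : h ^ 2 ≤ Dm ^ 3)
    (htD : (t - 1) * Dm ≤ Fintype.card (EV n) - 1) (hts : 2 * s' + 2 ≤ t)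
    (htN : t ≤ Fintype.card (EV n)) (hss : (v - 1).choose 2 < s') (hve : 4 * e ≤ v)
    (Ψ : Circuit (Fin (nP (n + 1))))
    (hV2 : (#((((powersetCard t (univ : Finset (EV n))).image (fun M => fun e => decide (e ∉ M)))).filter
        (fun x => Ψ.eval (fun j => decide (EvalCNF (cc n h j) x)) = true ∧
          (thetaGate (n + 1) (k - 1)).2 (fun j => decide (EvalCNF (cc n h j) x)) = false)) : ℝ) ≤
        ε * #(((powersetCard t (univ : Finset (EV n))).image (fun M => fun e => decide (e ∉ M)))))
    (𝓒 : Finset (Finset (Fin (nP (n + 1))))) (hCw : ∀ Q ∈ 𝓒, #Q = s')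
    (hCcard : #𝓒 ≤ Cmax)
    (hcase : ∀ u, EvalCNF 𝓒 u → Ψ.eval u = true)
    (Hi : (n + 1 : ℝ) * ((Fintype.card (EV n) - 1 - h).choose (t - 1) : ℝ) +
        ε * ((Fintype.card (EV n)).choose t : ℝ) +
        (Cmax : ℝ) * ((((s' : ℕ) : ℝ) + 1) * ((s' : ℕ) : ℝ) ^ s' *
          ((Fintype.card (EV n) - 1).choose (t - 1) : ℝ) / (Dm : ℝ) ^ e) <
        ((Fintype.card (EV n) - 1).choose (t - 1) : ℝ)) : False := by
  set NN := Fintype.card (EV n) with hNN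
  set ℳ : Finset (Finset (EV n)) := powersetCard t (univ : Finset (EV n)) with hℳ
  set ℬ : Finset (Finset (EV n)) := ℳ.filter (fun M => e0 n ∈ M) with hℬ
  have ht1 : 1 ≤ t := by omega
  have hℬcard : #ℬ = (NN - 1).choose (t - 1) := by
    have h1 := card_filter_supset ({e0 n} : Finset (EV n)) t (by rw [card_singleton]; exact ht1)
    rw [card_singleton] at h1
    rw [hℬ, hℳ, ← h1]
    congr 1
    exact filter_congr fun M _ => by rw [singleton_subset_iff]
  -- classified / classless anchored negatives
  set ℬ₀ := ℬ.filter (fun M => ∀ α : Fin (n + 1), ∃ γ, γ < h ∧ fE n α γ ∈ M) with hℬ₀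
  set ℬbad := ℬ.filter (fun M => ¬ ∀ α : Fin (n + 1), ∃ γ, γ < h ∧ fE n α γ ∈ M) with hℬbad
  have hsplit1 : #ℬ₀ + #ℬbad = #ℬ := Finset.card_filter_add_card_filter_not _
  -- the classless ones are few
  have hbad : #ℬbad ≤ (n + 1) * (NN - 1 - h).choose (t - 1) := by
    have hcov : ℬbad ⊆ (univ : Finset (Fin (n + 1))).biUnion fun α => ℳ.filter fun M =>
        ({e0 n} : Finset (EV n)) ⊆ M ∧ Disjoint ((range h).image (fE n α)) M := by
      intro M hM
      rw [mem_filter] at hM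
      obtain ⟨hMℬ, hbadM⟩ := hM
      simp only [not_forall, not_exists, not_and] at hbadM
      obtain ⟨α, hα⟩ := hbadM
      refine mem_biUnion.2 ⟨α, mem_univ _, mem_filter.2 ⟨(mem_filter.1 hMℬ).1, ?_, ?_⟩⟩
      · exact singleton_subset_iff.2 (mem_filter.1 hMℬ).2
      · exact disjoint_left.2 fun e he heM => by
          obtain ⟨γ, hγ, rfl⟩ := mem_image.1 he
          exact hα γ (mem_range.1 hγ) heM
    have hF : ∀ α : Fin (n + 1), #((range h).image (fE n α)) = h := by
      intro α
      rw [card_image_of_injOn, card_range]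
      intro γ hγ γ' hγ' hγγ
      exact (fE_inj n hh2 (mem_range.1 (mem_coe.1 hγ)) (mem_range.1 (mem_coe.1 hγ')) hγγ).2
    have hdisj : ∀ α : Fin (n + 1), Disjoint ({e0 n} : Finset (EV n)) ((range h).image (fE n α)) := by
      intro α
      rw [disjoint_singleton_left]
      intro he
      obtain ⟨γ, hγ, hγe⟩ := mem_image.1 he
      exact fE_ne_e0 n α (by have := mem_range.1 hγ; omega) hγe
    calc #ℬbad ≤ ∑ α : Fin (n + 1), #(ℳ.filter fun M =>
          ({e0 n} : Finset (EV n)) ⊆ M ∧ Disjoint ((range h).image (fE n α)) M) :=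
          (card_le_card hcov).trans card_biUnion_le
      _ = ∑ _α : Fin (n + 1), (NN - (1 + h)).choose (t - 1) := by
          refine sum_congr rfl fun α _ => ?_
          rw [hℳ, card_filter_supset_disjoint _ _ (hdisj α) t (by rw [card_singleton]; exact ht1),
            card_singleton, hF]
      _ = (n + 1) * (NN - 1 - h).choose (t - 1) := by
          rw [sum_const, smul_eq_mul, card_univ, Fintype.card_fin, Nat.sub_sub]
  -- the gate rejects every fully classified anchored negative
  have hrej : ∀ M ∈ ℬ₀, (thetaGate (n + 1) (k - 1)).2
      (fun j => decide (EvalCNF (cc n h j) (fun e => decide (e ∉ M)))) = false := by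
    intro M hM
    rw [mem_filter] at hM
    obtain ⟨hMℬ, hgood⟩ := hM
    have he : e0 n ∈ M := (mem_filter.1 hMℬ).2
    exact thetaGate_rejects (col n h M hgood) hhk _ (cval_le_colorVec n hh2 he hgood)
  -- split ℬ₀ by Ψ
  set ℬp := ℬ₀.filter (fun M =>
    Ψ.eval (fun j => decide (EvalCNF (cc n h j) (fun e => decide (e ∉ M)))) = true) with hℬp
  set ℬm := ℬ₀.filter (fun M =>
    ¬ Ψ.eval (fun j => decide (EvalCNF (cc n h j) (fun e => decide (e ∉ M)))) = true) with hℬm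
  have hsplit2 : #ℬp + #ℬm = #ℬ₀ := Finset.card_filter_add_card_filter_not _
  -- ℬp is small by (V2)
  have hplus : (#ℬp : ℝ) ≤ ε * NN.choose t := by
    have hinj : Set.InjOn (fun (M : Finset (EV n)) => fun e => decide (e ∉ M)) (ℬp : Set _) :=
      (negVec_injective n).injOn
    have hsub : ℬp.image (fun M => fun e => decide (e ∉ M)) ⊆
        (ℳ.image (fun M => fun e => decide (e ∉ M))).filter (fun x =>
          Ψ.eval (fun j => decide (EvalCNF (cc n h j) x)) = true ∧
            (thetaGate (n + 1) (k - 1)).2 (fun j => decide (EvalCNF (cc n h j) x)) = false) := by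
      intro x hx
      obtain ⟨M, hM, rfl⟩ := mem_image.1 hx
      rw [mem_filter] at hM ⊢
      exact ⟨mem_image_of_mem _ (mem_filter.1 (mem_filter.1 hM.1).1).1, hM.2, hrej M hM.1⟩
    have hN : #(ℳ.image (fun M => fun e => decide (e ∉ M))) ≤ NN.choose t := by
      calc _ ≤ #ℳ := card_image_le
        _ = NN.choose t := by simp [hℳ, card_powersetCard, hNN]
    calc (#ℬp : ℝ) = #(ℬp.image (fun M => fun e => decide (e ∉ M))) := by
          rw [card_image_of_injOn hinj]
      _ ≤ #((ℳ.image (fun M => fun e => decide (e ∉ M))).filter (fun x =>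
          Ψ.eval (fun j => decide (EvalCNF (cc n h j) x)) = true ∧
            (thetaGate (n + 1) (k - 1)).2 (fun j => decide (EvalCNF (cc n h j) x)) = false)) := by
          exact_mod_cast card_le_card hsub
      _ ≤ ε * #(ℳ.image (fun M => fun e => decide (e ∉ M))) := hV2
      _ ≤ ε * NN.choose t := by gcongr
  -- ℬm is covered by the off-events of the exact clauses
  have hminus_cov : ℬm ⊆ 𝓒.biUnion fun Q => ℳ.filter fun M =>
      e0 n ∈ M ∧ ∀ j ∈ Q, ∃ γ, γ < h ∧ ∀ α ∈ verts n (pr n j), fE n α γ ∈ M := by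
    intro M hM
    rw [mem_filter] at hM
    obtain ⟨hM0, hΨ⟩ := hM
    have hMℬ : M ∈ ℬ := (mem_filter.1 hM0).1
    have he : e0 n ∈ M := (mem_filter.1 hMℬ).2
    have hnot : ¬ EvalCNF 𝓒 (fun j => decide (EvalCNF (cc n h j) (fun e => decide (e ∉ M)))) :=
      fun hev => hΨ (hcase _ hev)
    have hex : ∃ Q ∈ 𝓒, ¬ SatClause Q (fun j => decide (EvalCNF (cc n h j) (fun e => decide (e ∉ M)))) := by
      by_contra hall
      exact hnot fun Q hQ => by_contra fun hs => hall ⟨Q, hQ, hs⟩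
    obtain ⟨Q, hQ, hQsat⟩ := hex
    refine mem_biUnion.2 ⟨Q, hQ, mem_filter.2 ⟨(mem_filter.1 hMℬ).1, he, fun j hj => ?_⟩⟩
    have hoff : decide (EvalCNF (cc n h j) (fun e => decide (e ∉ M))) = false := by
      cases hb : decide (EvalCNF (cc n h j) (fun e => decide (e ∉ M))) with
      | false => rfl
      | true => exact absurd ⟨j, hj, hb⟩ hQsat
    exact (cval_false_iff n hh2 he j).1 hoff
  -- per-clause bound
  have hbound_nonneg : (0 : ℝ) ≤ (((s' : ℕ) : ℝ) + 1) * ((s' : ℕ) : ℝ) ^ s' *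
      ((NN - 1).choose (t - 1) : ℝ) / (Dm : ℝ) ^ e := by positivity
  have hQ : ∀ Q ∈ 𝓒, (#(ℳ.filter fun M =>
      e0 n ∈ M ∧ ∀ j ∈ Q, ∃ γ, γ < h ∧ ∀ α ∈ verts n (pr n j), fE n α γ ∈ M) : ℝ) ≤
      (((s' : ℕ) : ℝ) + 1) * ((s' : ℕ) : ℝ) ^ s' * ((NN - 1).choose (t - 1) : ℝ) / (Dm : ℝ) ^ e := by
    intro Q hQ𝓒
    have hQcard : #Q = s' := hCw Q hQ𝓒
    -- cover by class assignments `g : Q → Fin h`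
    have hcov : (ℳ.filter fun M =>
        e0 n ∈ M ∧ ∀ j ∈ Q, ∃ γ, γ < h ∧ ∀ α ∈ verts n (pr n j), fE n α γ ∈ M) ⊆
        (univ : Finset (Q → Fin h)).biUnion fun g => ℳ.filter fun M => Gset n g ⊆ M := by
      intro M hM
      rw [mem_filter] at hM
      obtain ⟨hMℳ, he, hall⟩ := hM
      choose γf hγf hγM using hall
      refine mem_biUnion.2 ⟨fun j => ⟨γf j.1 j.2, hγf j.1 j.2⟩, mem_univ _, mem_filter.2 ⟨hMℳ, ?_⟩⟩
      intro e he'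
      rw [Gset, mem_insert] at he'
      rcases he' with rfl | he'
      · exact he
      · obtain ⟨x, hx, rfl⟩ := mem_image.1 he'
        obtain ⟨j, hxj, hgj⟩ := (mem_Inc_iff _ x).1 hx
        have h1 := hγM j.1 j.2 x.1 hxj
        have h2 : γf j.1 j.2 = x.2.1 := by rw [← hgj]
        rw [h2] at h1
        exact h1
    -- per-assignment bound
    have hNN2 : 2 ≤ NN := by omega
    have hg : ∀ g : Q → Fin h, (#(ℳ.filter fun M => Gset n g ⊆ M) : ℝ) *
        ((h : ℝ) ^ #((univ : Finset Q).image g) * (Dm : ℝ) ^ e) ≤ (NN - 1).choose (t - 1) := by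
      intro g
      set ι := #(Inc g) with hι
      have hιle : ι ≤ 2 * s' := by rw [hι, ← hQcard]; exact card_Inc_le g
      have hGcard : #(Gset n g) = ι + 1 := card_Gset hh2 g
      have hcnt : #(ℳ.filter fun M => Gset n g ⊆ M) = (NN - (ι + 1)).choose (t - (ι + 1)) := by
        rw [hℳ, card_filter_supset _ _ (by rw [hGcard]; omega), hGcard]
      have hratio := choose_sub_sub_mul_pow_le (NN - 1) (t - 1) (by omega) ι (by omega)
      have hpow : ((t - 1) * Dm) ^ ι ≤ (NN - 1) ^ ι := Nat.pow_le_pow_left htD ι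
      have hmain : (NN - 1 - ι).choose (t - 1 - ι) * Dm ^ ι ≤ (NN - 1).choose (t - 1) := by
        have hNNpos : 0 < (NN - 1) ^ ι := Nat.pow_pos (by omega)
        refine Nat.le_of_mul_le_mul_right ?_ hNNpos
        calc (NN - 1 - ι).choose (t - 1 - ι) * Dm ^ ι * (NN - 1) ^ ι
            = (NN - 1 - ι).choose (t - 1 - ι) * (NN - 1) ^ ι * Dm ^ ι := by ring
          _ ≤ (NN - 1).choose (t - 1) * (t - 1) ^ ι * Dm ^ ι := Nat.mul_le_mul_right _ hratio
          _ = (NN - 1).choose (t - 1) * ((t - 1) * Dm) ^ ι := by ring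
          _ ≤ (NN - 1).choose (t - 1) * (NN - 1) ^ ι := Nat.mul_le_mul_left _ hpow
      set c := #((univ : Finset Q).image g) with hc
      have hι1 : v ≤ ι :=
        (le_card_spanV n Q v (by rw [hQcard]; exact hss)).trans (card_spanV_le_card_Inc g)
      have hι2 : 2 * c ≤ ι := two_mul_card_image_le_card_Inc g
      have hmax : max (4 * e) (2 * c) ≤ ι := max_le (by omega) hι2
      have hkey : h ^ c * Dm ^ e ≤ Dm ^ ι :=
        (pow_mul_pow_le_pow_max hhD hD1 c e).trans (Nat.pow_le_pow_right hD1 hmax)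
      have hfin : (NN - (ι + 1)).choose (t - (ι + 1)) * (h ^ c * Dm ^ e) ≤
          (NN - 1).choose (t - 1) := by
        have e1 : NN - (ι + 1) = NN - 1 - ι := by omega
        have e2 : t - (ι + 1) = t - 1 - ι := by omega
        rw [e1, e2]
        exact (Nat.mul_le_mul_left _ hkey).trans hmain
      rw [hcnt]
      exact_mod_cast hfin
    have hhpos : (0 : ℝ) < h := by exact_mod_cast hh1
    have hDpos : (0 : ℝ) < Dm := by exact_mod_cast hD1
    calc (#(ℳ.filter fun M =>
          e0 n ∈ M ∧ ∀ j ∈ Q, ∃ γ, γ < h ∧ ∀ α ∈ verts n (pr n j), fE n α γ ∈ M) : ℝ)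
        ≤ #((univ : Finset (Q → Fin h)).biUnion fun g => ℳ.filter fun M => Gset n g ⊆ M) := by
          exact_mod_cast card_le_card hcov
      _ ≤ ∑ g : Q → Fin h, (#(ℳ.filter fun M => Gset n g ⊆ M) : ℝ) := by
          exact_mod_cast card_biUnion_le
      _ ≤ ∑ g : Q → Fin h, ((NN - 1).choose (t - 1) : ℝ) /
            ((h : ℝ) ^ #((univ : Finset Q).image g) * (Dm : ℝ) ^ e) := by
          refine sum_le_sum fun g _ => ?_
          rw [le_div_iff₀ (by positivity)]
          exact hg g
      _ = ((NN - 1).choose (t - 1) : ℝ) / (Dm : ℝ) ^ e *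
            ∑ g : Q → Fin h, ((h : ℝ) ^ #((univ : Finset Q).image g))⁻¹ := by
          rw [mul_sum]
          refine sum_congr rfl fun g _ => ?_
          rw [div_eq_mul_inv, div_eq_mul_inv, mul_inv]
          ring
      _ ≤ ((NN - 1).choose (t - 1) : ℝ) / (Dm : ℝ) ^ e *
            ((Fintype.card Q + 1) * (Fintype.card Q : ℝ) ^ (Fintype.card Q)) := by
          gcongr
          exact sum_inv_pow_card_image_le h hh1
      _ = (((s' : ℕ) : ℝ) + 1) * ((s' : ℕ) : ℝ) ^ s' * ((NN - 1).choose (t - 1) : ℝ) / (Dm : ℝ) ^ e := by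
          rw [Fintype.card_coe, hQcard]
          ring
  have hminus : (#ℬm : ℝ) ≤ (Cmax : ℝ) *
      ((((s' : ℕ) : ℝ) + 1) * ((s' : ℕ) : ℝ) ^ s' * ((NN - 1).choose (t - 1) : ℝ) / (Dm : ℝ) ^ e) := by
    have hC' : (#𝓒 : ℝ) ≤ (Cmax : ℝ) := by exact_mod_cast hCcard
    calc (#ℬm : ℝ) ≤ #(𝓒.biUnion fun Q => ℳ.filter fun M =>
          e0 n ∈ M ∧ ∀ j ∈ Q, ∃ γ, γ < h ∧ ∀ α ∈ verts n (pr n j), fE n α γ ∈ M) := by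
          exact_mod_cast card_le_card hminus_cov
      _ ≤ ∑ Q ∈ 𝓒, (#(ℳ.filter fun M =>
          e0 n ∈ M ∧ ∀ j ∈ Q, ∃ γ, γ < h ∧ ∀ α ∈ verts n (pr n j), fE n α γ ∈ M) : ℝ) := by
          exact_mod_cast card_biUnion_le
      _ ≤ ∑ _Q ∈ 𝓒, (((s' : ℕ) : ℝ) + 1) * ((s' : ℕ) : ℝ) ^ s' * ((NN - 1).choose (t - 1) : ℝ) /
            (Dm : ℝ) ^ e := sum_le_sum hQ
      _ = #𝓒 * ((((s' : ℕ) : ℝ) + 1) * ((s' : ℕ) : ℝ) ^ s' * ((NN - 1).choose (t - 1) : ℝ) /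
            (Dm : ℝ) ^ e) := by rw [sum_const, nsmul_eq_mul]
      _ ≤ _ := mul_le_mul_of_nonneg_right hC' hbound_nonneg
  -- assemble
  have htot : ((NN - 1).choose (t - 1) : ℝ) = #ℬbad + #ℬp + #ℬm := by
    rw [← hℬcard, ← hsplit1, ← hsplit2]; push_cast; ring
  have hbad' : (#ℬbad : ℝ) ≤ (n + 1) * (NN - 1 - h).choose (t - 1) := by exact_mod_cast hbad
  linarith [hplus, hminus, Hi, htot, hbad']

end FiniteNeg

end

end Summit.PneNP.PneNP.Theorems.CliqueExtLowerBound.Negative
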